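import Summits.BirchSwinnertonDyer.BirchSwinnertonDyer.Theorems.ResidualThetaTransportAtTwoThetaLayerLambdaCongruenceAtTwoCurveMuSeed
import Summits.BirchSwinnertonDyer.BirchSwinnertonDyer.Theorems.ResidualThetaTransportAtTwoThetaLayerLambdaCongruenceAtTwoCurveMuPropagationAnyRank
import Summits.BirchSwinnertonDyer.BirchSwinnertonDyer.Theorems.ResidualThetaTransportAtTwoThetaLayerLambdaCongruenceAtTwoPartnerMuTransfer
import HarnessLib

/-!
# Crux `ThetaLayerLambdaCongruenceAtTwo` (stmt-BirchSwinnertonDyer-20688, route ResidualThetaTransportAtTwo), line `birth`: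
# the two SEED forms of the `μ`-node, assembled — a `2`-congruent curve `A` of ANY rank, or the CM PARTNER FORM `g` itself

Width seat bsd-wall-rtt-p3-w2 g2 (`--supports stmt-BirchSwinnertonDyer-20688`; closes nothing). THEOREMS ONLY — no definition, no named
fact, no `sorry`; every research input is an explicit hypothesis; nothing about any curve or form is asserted; BSD is not proved.

WHAT. `…CurveMuSeed` (p614500) derives the crux's conclusion at a datum — and Kan⁺ BY NAME — from the seven named facts and ONE
`2`-congruent curve `A` with (μ-W₀)(A), asking `analyticRank A = 0`; `…CurveMuPropagationAnyRank` removes that hypothesis from the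
propagation step (the depleted symbol of EVERY elliptic curve is non-zero and primitively scalable: injectivity of depletion + Deligne).
This file composes the two:
* `layerLambda_eventually_eq_of_facts_congruentSeedAnyRank_at` — crux conclusion at a datum ⟸ seven facts + ONE `2`-congruent `A`
  (good supersingular at `2`, `a₂(A) = 0`, newform `f_A`, trace-congruent to `W` off `N_W N_A`, `bad(A) ⊆ S₀`; NO rank hypothesis)
  with (μ-W₀)(A);
* `thetaLayerLambdaCongruenceAtTwo_of_facts_congruentSeedAnyRank` — **Kan⁺ BY NAME ⟸ seven facts + «every crux datum admits such
  an `A` (any rank) supported in `bad(W) ∪ primes(M)` with (μ-W₀)(A)»** — on the theta habitat `A` := the rational CM partner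
  curve of `g` whatever its rank, i.e. Kan⁺'s `μ`-node is seeded by (μ-W₀)/FLAT of the CM partners (TP2's (μ♭)_A node);
* `layerLambda_eventually_eq_of_facts_partnerSymbolMax_at` / `thetaLayerLambdaCongruenceAtTwo_of_facts_partnerSymbolMax` — the
  PARTNER seed (`…PartnerMuTransfer`): **crux conclusion at a datum, and Kan⁺ BY NAME, ⟸ seven facts + (μ-g₁)** «for every crux datum and
  every admissible `S₀`, the `S₀`-depleted plus symbol of the CM partner `(g, Ω, ι)` attains its `2`-adic maximum over `ℚ` at a `2`-power
  cusp of an even layer» — the `μ`-node placed on the partner form (any coefficient field, any plus period), at the crux's own `S₀`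
  (ThetaPartnerAtTwo's `μ`-clause currency; cf. item 21438's docstring «the seed IS TP2's K2 `μ`-clause in substance»).

References: [GreenbergVatsal2000] Thm. (1.4), §1 (10); [PollackWeston2011MT] Rem. 4.2; [Pollack2003] Conj. 6.3; [Deligne1974] Thm. (8.2).
-/

set_option autoImplicit false
-- justification: the `Summit.BirchSwinnertonDyer.BirchSwinnertonDyer.…` path repeats a component (route-file convention)
set_option linter.dupNamespace false

noncomputable section

open scoped Classical MatrixGroups Polynomial

open CongruenceSubgroup Literature.NumberTheory.EllipticCurves Literature.NumberTheory.EllipticCurves.ModularForms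
open Literature.NumberTheory.IwasawaTheory

namespace Summit.BirchSwinnertonDyer.BirchSwinnertonDyer.Theorems.ThetaLayerLambdaCongruenceAtTwo

/-- **Crux conclusion at a datum ⟸ seven facts + ONE `2`-congruent curve `A` of ANY analytic rank with (μ-W₀)(A)** (`bad(A) ⊆ S₀`):
`curveDepletedSymbolMax_of_congruent_of_plusSymbolMax_of_deligne` + `layerLambda_eventually_eq_of_facts_curveMax_at`.
[cite: GreenbergVatsal2000, Thm. (1.4) (shape)] [cite: Deligne1974, Thm. (8.2)] -/
theorem layerLambda_eventually_eq_of_facts_congruentSeedAnyRank_at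
    (hES : eichlerShimura_depletedOptimalQuotient_periodLattice_of_dvd)
    (hF : WeierstrassCurve.isIsogenous_iff_frobeniusTrace_eq) (hMK : mazurKenku_exists_cyclic_isogeny)
    (hSD : heckeSelfDual_torsionBy_J0) (hBz : buzzard2000_multiplicityOne_gamma0)
    (hSe : serre1972_supersingular_decompositionSubgroup_image) (hD : Deligne1974_heckeT_eigenvalue_norm_le)
    {W : WeierstrassCurve ℚ} [W.IsElliptic] [W.IsGloballyMinimal]
    (hr : W.analyticRank = 0) (hss : Literature.NumberTheory.EllipticCurves.Rank1Residual.GoodSS W 2)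
    (ha : W.frobeniusTrace 2 = 0) (hΔ : W.Δ < 0) {M : ℕ} [NeZero M] (g : CuspForm (CongruenceSubgroup.Gamma0 M) 2)
    (ι : Literature.NumberTheory.EllipticCurves.ModularForms.coeffField g →+* PadicAlgCl 2) (Ω : ℂ) (hodd : Odd M)
    (hnew : Literature.NumberTheory.EllipticCurves.ModularForms.IsNewform0 g)
    (ha2 : Literature.NumberTheory.EllipticCurves.ModularForms.cuspCoeff g 2 = 0)
    (hΩ : Literature.NumberTheory.EllipticCurves.IsPlusPeriod g Ω)
    (hcong : ∀ ℓ : ℕ, ℓ.Prime → ¬ ℓ ∣ 2 * M * W.conductorNorm ℤ → ‖Literature.NumberTheory.EllipticCurves.embCoeff g ι ℓ - (W.frobeniusTrace ℓ : PadicAlgCl 2)‖ < 1)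
    [NeZero (W.conductorNorm ℤ)] {f : CuspForm (CongruenceSubgroup.Gamma0 (W.conductorNorm ℤ)) 2}
    (hf : Literature.NumberTheory.EllipticCurves.ModularForms.IsNewformOf W f)
    (S₀ : Finset (IsDedekindDomain.HeightOneSpectrum (NumberField.RingOfIntegers ℚ)))
    (hS2 : ∀ v ∈ S₀, ((2 : ℕ) : NumberField.RingOfIntegers ℚ) ∉ v.asIdeal)
    (hSW : ∀ v : IsDedekindDomain.HeightOneSpectrum (NumberField.RingOfIntegers ℚ), ¬ W.HasGoodReductionAt v → v ∈ S₀)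
    (hSM : ∀ v : IsDedekindDomain.HeightOneSpectrum (NumberField.RingOfIntegers ℚ), Rat.HeightOneSpectrum.natGenerator v ∣ M → v ∈ S₀)
    {A : WeierstrassCurve ℚ} [A.IsElliptic] [A.IsGloballyMinimal] [NeZero (A.conductorNorm ℤ)]
    {fA : CuspForm (CongruenceSubgroup.Gamma0 (A.conductorNorm ℤ)) 2}
    (hssA : Literature.NumberTheory.EllipticCurves.Rank1Residual.GoodSS A 2) (haA : A.frobeniusTrace 2 = 0)
    (hfA : Literature.NumberTheory.EllipticCurves.ModularForms.IsNewformOf A fA)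
    (hcongA : ∀ q : ℕ, q.Prime → ¬ q ∣ W.conductorNorm ℤ → ¬ q ∣ A.conductorNorm ℤ →
      ‖(A.LFunction q : PadicAlgCl 2) - (W.LFunction q : PadicAlgCl 2)‖ < 1)
    (hSA : ∀ v : IsDedekindDomain.HeightOneSpectrum (NumberField.RingOfIntegers ℚ), ¬ A.HasGoodReductionAt v → v ∈ S₀)
    (hμ0A : ∃ n₁ : ℕ, Even n₁ ∧ ∃ s : ZMod (2 ^ n₁), ∀ r : ℚ, ‖algebraMap ℚ (PadicAlgCl 2) (ratPlusSymbol fA (r))‖ ≤ ‖algebraMap ℚ (PadicAlgCl 2) (ratPlusSymbol fA (((((cyclotomicGenerator 2 : ZMod (2 ^ ((n₁) + 2))) ^ (s).val).val : ℚ) / (2 : ℚ) ^ ((n₁) + 2))))‖) :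
    ∃ n₀ : ℕ, ∀ n ≥ n₀, Even n → Literature.NumberTheory.IwasawaTheory.layerLambda (((Literature.NumberTheory.EllipticCurves.mazurTateElement f 2 n).map (algebraMap ℚ (PadicAlgCl 2)) * ∏ v ∈ S₀, ((W.localPolynomialAt v).map (Int.castRingHom (PadicAlgCl 2))).comp (Polynomial.C ((Rat.HeightOneSpectrum.natGenerator v : PadicAlgCl 2)⁻¹) * (Polynomial.X + 1) ^ (PadicInt.toZModPow n (-(Literature.NumberTheory.EllipticCurves.GreenbergVatsal2000.frobeniusExponent 2 (Rat.HeightOneSpectrum.natGenerator v : ℤ_[2])))).val)) %ₘ ((Polynomial.X + 1) ^ 2 ^ n - 1)) = Literature.NumberTheory.IwasawaTheory.layerLambda (((Literature.NumberTheory.EllipticCurves.mazurTateElementK g Ω 2 n).map ι * ∏ v ∈ S₀, (1 - Polynomial.C (Literature.NumberTheory.EllipticCurves.embCoeff g ι (Rat.HeightOneSpectrum.natGenerator v)) * Polynomial.X + (if Rat.HeightOneSpectrum.natGenerator v ∣ M then 0 else Polynomial.C (Rat.HeightOneSpectrum.natGenerator v : PadicAlgCl 2)) * Polynomial.X ^ 2).comp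 (Polynomial.C ((Rat.HeightOneSpectrum.natGenerator v : PadicAlgCl 2)⁻¹) * (Polynomial.X + 1) ^ (PadicInt.toZModPow n (-(Literature.NumberTheory.EllipticCurves.GreenbergVatsal2000.frobeniusExponent 2 (Rat.HeightOneSpectrum.natGenerator v : ℤ_[2])))).val)) %ₘ ((Polynomial.X + 1) ^ 2 ^ n - 1)) :=
  layerLambda_eventually_eq_of_facts_curveMax_at hES hF hMK hSD hBz hSe hD hr hss ha hΔ g ι Ω hodd hnew ha2 hΩ hcong hf S₀
    hS2 hSW hSM
    (curveDepletedSymbolMax_of_congruent_of_plusSymbolMax_of_deligne hES hF hMK hSD hBz hSe hD hss hΔ hf hr hssA haA hfA hcongA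
      hμ0A S₀ hS2 hSW hSA)

/-- **Kan⁺ `ThetaLayerLambdaCongruenceAtTwo` BY NAME ⟸ seven named facts + the ANALYTIC SEED, any rank**: every crux datum
`(W, M, g, ι, Ω, f)` admits a `2`-congruent curve `A` (good supersingular at `2`, `a₂(A) = 0`, newform `f_A`, `|a_q(A) − a_q(W)|₂ < 1` off
`N_W N_A`, NO rank hypothesis) whose bad places are bad for `W` or lie over `M`, with (μ-W₀)(A, f_A). On the theta habitat `A` := the
rational CM partner curve of `g`. BSD is not proved by this. [cite: GreenbergVatsal2000, Thm. (1.4) (shape)] [cite: Pollack2003, Conj. 6.3] -/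
theorem thetaLayerLambdaCongruenceAtTwo_of_facts_congruentSeedAnyRank
    (hES : eichlerShimura_depletedOptimalQuotient_periodLattice_of_dvd)
    (hF : WeierstrassCurve.isIsogenous_iff_frobeniusTrace_eq) (hMK : mazurKenku_exists_cyclic_isogeny)
    (hSD : heckeSelfDual_torsionBy_J0) (hBz : buzzard2000_multiplicityOne_gamma0)
    (hSe : serre1972_supersingular_decompositionSubgroup_image) (hD : Deligne1974_heckeT_eigenvalue_norm_le)
    (hSeed : ∀ (W : WeierstrassCurve ℚ) [W.IsElliptic] [W.IsGloballyMinimal], ¬ W.HasCM → W.analyticRank = 0 → Literature.NumberTheory.EllipticCurves.Rank1Residual.GoodSS W 2 → W.frobeniusTrace 2 = 0 → W.Δ < 0 → ∀ (M : ℕ) [NeZero M] (g : CuspForm (CongruenceSubgroup.Gamma0 M) 2) (ι : Literature.NumberTheory.EllipticCurves.ModularForms.coeffField g →+* PadicAlgCl 2) (Ω : ℂ), Odd M → Literature.NumberTheory.EllipticCurves.ModularForms.IsNewform0 g → Literature.NumberTheory.Automorphic.IsCMForm (Literature.NumberTheory.EllipticCurves.ModularForms.liftToGamma1 M 2 g)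 → Literature.NumberTheory.EllipticCurves.ModularForms.cuspCoeff g 2 = 0 → Literature.NumberTheory.EllipticCurves.IsPlusPeriod g Ω → (∀ ℓ : ℕ, ℓ.Prime → ¬ ℓ ∣ 2 * M * W.conductorNorm ℤ → ‖Literature.NumberTheory.EllipticCurves.embCoeff g ι ℓ - (W.frobeniusTrace ℓ : PadicAlgCl 2)‖ < 1) → ∀ [NeZero (W.conductorNorm ℤ)] (f : CuspForm (CongruenceSubgroup.Gamma0 (W.conductorNorm ℤ)) 2), Literature.NumberTheory.EllipticCurves.ModularForms.IsNewformOf W f → ∃ (A : WeierstrassCurve ℚ) (_ : A.IsElliptic) (_ : A.IsGloballyMinimal) (_ : NeZero (A.conductorNorm ℤ)) (fA : CuspForm (CongruenceSubgroup.Gamma0 (A.conductorNorm ℤ)) 2), Literature.NumberTheory.EllipticCurves.Rank1Residual.GoodSS A 2 ∧ A.frobeniusTrace 2 = 0 ∧ Literature.NumberTheory.EllipticCurves.ModularForms.IsNewformOf A fA ∧ (∀ q : ℕ, q.Prime → ¬ q ∣ W.conductorNorm ℤ → ¬ q ∣ A.conductorNorm ℤ → ‖(A.LFunction q : PadicAlgCl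 2) - (W.LFunction q : PadicAlgCl 2)‖ < 1) ∧ (∀ v : IsDedekindDomain.HeightOneSpectrum (NumberField.RingOfIntegers ℚ), ¬ A.HasGoodReductionAt v → ¬ W.HasGoodReductionAt v ∨ Rat.HeightOneSpectrum.natGenerator v ∣ M) ∧ (∃ n₁ : ℕ, Even n₁ ∧ ∃ s : ZMod (2 ^ n₁), ∀ r : ℚ, ‖algebraMap ℚ (PadicAlgCl 2) (ratPlusSymbol fA (r))‖ ≤ ‖algebraMap ℚ (PadicAlgCl 2) (ratPlusSymbol fA (((((cyclotomicGenerator 2 : ZMod (2 ^ ((n₁) + 2))) ^ (s).val).val : ℚ) / (2 : ℚ) ^ ((n₁) + 2))))‖)) :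
    Summit.BirchSwinnertonDyer.BirchSwinnertonDyer.Theses.ResidualThetaTransportAtTwo.ThetaLayerLambdaCongruenceAtTwo := by
  intro W _ _ hcm hr hss ha hΔ M _ g ι Ω hodd hnew hcmg ha2 hΩ hcong _ f hf S₀ hS2 hSW hSM
  obtain ⟨A, _, _, _, fA, hssA, haA, hfA, hcongA, hsupp, hμ0A⟩ :=
    hSeed W hcm hr hss ha hΔ M g ι Ω hodd hnew hcmg ha2 hΩ hcong f hf
  exact layerLambda_eventually_eq_of_facts_congruentSeedAnyRank_at hES hF hMK hSD hBz hSe hD hr hss ha hΔ g ι Ω hodd hnew ha2 hΩ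
    hcong hf S₀ hS2 hSW hSM hssA haA hfA hcongA (fun v hv ↦ (hsupp v hv).elim (hSW v) (hSM v)) hμ0A

/-- **Crux conclusion at a datum ⟸ seven facts + (μ-g₁) at the datum** (the partner form's depleted plus symbol attains its `2`-adic
maximum over `ℚ` at an even-layer `2`-power cusp): `curveDepletedSymbolMax_of_partnerSymbolMax` (`…PartnerMuTransfer`) +
`layerLambda_eventually_eq_of_facts_curveMax_at`. [cite: GreenbergVatsal2000, Thm. (1.4) (shape)] [cite: Vatsal1999, §1.6] -/
theorem layerLambda_eventually_eq_of_facts_partnerSymbolMax_at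
    (hES : eichlerShimura_depletedOptimalQuotient_periodLattice_of_dvd)
    (hF : WeierstrassCurve.isIsogenous_iff_frobeniusTrace_eq) (hMK : mazurKenku_exists_cyclic_isogeny)
    (hSD : heckeSelfDual_torsionBy_J0) (hBz : buzzard2000_multiplicityOne_gamma0)
    (hSe : serre1972_supersingular_decompositionSubgroup_image) (hD : Deligne1974_heckeT_eigenvalue_norm_le)
    {W : WeierstrassCurve ℚ} [W.IsElliptic] [W.IsGloballyMinimal]
    (hr : W.analyticRank = 0) (hss : Literature.NumberTheory.EllipticCurves.Rank1Residual.GoodSS W 2)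
    (ha : W.frobeniusTrace 2 = 0) (hΔ : W.Δ < 0) {M : ℕ} [NeZero M] (g : CuspForm (CongruenceSubgroup.Gamma0 M) 2)
    (ι : Literature.NumberTheory.EllipticCurves.ModularForms.coeffField g →+* PadicAlgCl 2) (Ω : ℂ) (hodd : Odd M)
    (hnew : Literature.NumberTheory.EllipticCurves.ModularForms.IsNewform0 g)
    (ha2 : Literature.NumberTheory.EllipticCurves.ModularForms.cuspCoeff g 2 = 0)
    (hΩ : Literature.NumberTheory.EllipticCurves.IsPlusPeriod g Ω)
    (hcong : ∀ ℓ : ℕ, ℓ.Prime → ¬ ℓ ∣ 2 * M * W.conductorNorm ℤ → ‖Literature.NumberTheory.EllipticCurves.embCoeff g ι ℓ - (W.frobeniusTrace ℓ : PadicAlgCl 2)‖ < 1)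
    [NeZero (W.conductorNorm ℤ)] {f : CuspForm (CongruenceSubgroup.Gamma0 (W.conductorNorm ℤ)) 2}
    (hf : Literature.NumberTheory.EllipticCurves.ModularForms.IsNewformOf W f)
    (S₀ : Finset (IsDedekindDomain.HeightOneSpectrum (NumberField.RingOfIntegers ℚ)))
    (hS2 : ∀ v ∈ S₀, ((2 : ℕ) : NumberField.RingOfIntegers ℚ) ∉ v.asIdeal)
    (hSW : ∀ v : IsDedekindDomain.HeightOneSpectrum (NumberField.RingOfIntegers ℚ), ¬ W.HasGoodReductionAt v → v ∈ S₀)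
    (hSM : ∀ v : IsDedekindDomain.HeightOneSpectrum (NumberField.RingOfIntegers ℚ), Rat.HeightOneSpectrum.natGenerator v ∣ M → v ∈ S₀)
    (hμg : ∃ n₁ : ℕ, Even n₁ ∧ ∃ s : ZMod (2 ^ n₁), ∀ r : ℚ, ‖(∑ k ∈ Fintype.piFinset (fun _ : S₀ ↦ Finset.range 3), (∏ v : S₀, (1 - Polynomial.C (embCoeff g ι (Rat.HeightOneSpectrum.natGenerator (v : IsDedekindDomain.HeightOneSpectrum (NumberField.RingOfIntegers ℚ)))) * Polynomial.X + (if Rat.HeightOneSpectrum.natGenerator (v : IsDedekindDomain.HeightOneSpectrum (NumberField.RingOfIntegers ℚ)) ∣ M then 0 else Polynomial.C (Rat.HeightOneSpectrum.natGenerator (v : IsDedekindDomain.HeightOneSpectrum (NumberField.RingOfIntegers ℚ)) : PadicAlgCl 2)) * Polynomial.X ^ 2 : Polynomial (PadicAlgCl 2)).coeff (k v) * ((Rat.HeightOneSpectrum.natGenerator (v : IsDedekindDomain.HeightOneSpectrum (NumberField.RingOfIntegers ℚ)) : PadicAlgCl 2)⁻¹) ^ (k v)) * ι (plusSymbolK g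 Ω (r * ((∏ v : S₀, Rat.HeightOneSpectrum.natGenerator (v : IsDedekindDomain.HeightOneSpectrum (NumberField.RingOfIntegers ℚ)) ^ (k v) : ℕ) : ℚ))))‖ ≤ ‖(∑ k ∈ Fintype.piFinset (fun _ : S₀ ↦ Finset.range 3), (∏ v : S₀, (1 - Polynomial.C (embCoeff g ι (Rat.HeightOneSpectrum.natGenerator (v : IsDedekindDomain.HeightOneSpectrum (NumberField.RingOfIntegers ℚ)))) * Polynomial.X + (if Rat.HeightOneSpectrum.natGenerator (v : IsDedekindDomain.HeightOneSpectrum (NumberField.RingOfIntegers ℚ)) ∣ M then 0 else Polynomial.C (Rat.HeightOneSpectrum.natGenerator (v : IsDedekindDomain.HeightOneSpectrum (NumberField.RingOfIntegers ℚ)) : PadicAlgCl 2)) * Polynomial.X ^ 2 : Polynomial (PadicAlgCl 2)).coeff (k v) * ((Rat.HeightOneSpectrum.natGenerator (v : IsDedekindDomain.HeightOneSpectrum (NumberField.RingOfIntegers ℚ)) : PadicAlgCl 2)⁻¹) ^ (k v)) * ι (plusSymbolK g Ω ((((((Literature.NumberTheory.EllipticCurves.cyclotomicGenerator 2 : ZMod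 (2 ^ (n₁ + 2))) ^ s.val).val : ℚ) / (2 : ℚ) ^ (n₁ + 2))) * ((∏ v : S₀, Rat.HeightOneSpectrum.natGenerator (v : IsDedekindDomain.HeightOneSpectrum (NumberField.RingOfIntegers ℚ)) ^ (k v) : ℕ) : ℚ))))‖) :
    ∃ n₀ : ℕ, ∀ n ≥ n₀, Even n → Literature.NumberTheory.IwasawaTheory.layerLambda (((Literature.NumberTheory.EllipticCurves.mazurTateElement f 2 n).map (algebraMap ℚ (PadicAlgCl 2)) * ∏ v ∈ S₀, ((W.localPolynomialAt v).map (Int.castRingHom (PadicAlgCl 2))).comp (Polynomial.C ((Rat.HeightOneSpectrum.natGenerator v : PadicAlgCl 2)⁻¹) * (Polynomial.X + 1) ^ (PadicInt.toZModPow n (-(Literature.NumberTheory.EllipticCurves.GreenbergVatsal2000.frobeniusExponent 2 (Rat.HeightOneSpectrum.natGenerator v : ℤ_[2])))).val)) %ₘ ((Polynomial.X + 1) ^ 2 ^ n - 1)) = Literature.NumberTheory.IwasawaTheory.layerLambda (((Literature.NumberTheory.EllipticCurves.mazurTateElementK g Ω 2 n).map ι * ∏ v ∈ S₀, (1 - Polynomial.C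 (Literature.NumberTheory.EllipticCurves.embCoeff g ι (Rat.HeightOneSpectrum.natGenerator v)) * Polynomial.X + (if Rat.HeightOneSpectrum.natGenerator v ∣ M then 0 else Polynomial.C (Rat.HeightOneSpectrum.natGenerator v : PadicAlgCl 2)) * Polynomial.X ^ 2).comp (Polynomial.C ((Rat.HeightOneSpectrum.natGenerator v : PadicAlgCl 2)⁻¹) * (Polynomial.X + 1) ^ (PadicInt.toZModPow n (-(Literature.NumberTheory.EllipticCurves.GreenbergVatsal2000.frobeniusExponent 2 (Rat.HeightOneSpectrum.natGenerator v : ℤ_[2])))).val)) %ₘ ((Polynomial.X + 1) ^ 2 ^ n - 1)) :=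
  layerLambda_eventually_eq_of_facts_curveMax_at hES hF hMK hSD hBz hSe hD hr hss ha hΔ g ι Ω hodd hnew ha2 hΩ hcong hf S₀
    hS2 hSW hSM
    (curveDepletedSymbolMax_of_partnerSymbolMax hES hF hMK hSD hBz hSe hD hr hss ha hΔ g ι Ω hodd hnew ha2 hΩ hcong hf S₀
      hS2 hSW hSM hμg)

/-- **Kan⁺ `ThetaLayerLambdaCongruenceAtTwo` BY NAME ⟸ seven named facts + (μ-g₁) for every crux datum** («the `S₀`-depleted plus symbol
of the CM partner `(g, Ω, ι)` attains its `2`-adic maximum over `ℚ` at a `2`-power cusp of an even layer», for every admissible `S₀`):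
the `μ`-node of the line read on the PARTNER side. BSD is not proved by this. [cite: GreenbergVatsal2000, Thm. (1.4) and §1 (10) (shape)]
[cite: PollackWeston2011MT, Rem. 4.2] -/
theorem thetaLayerLambdaCongruenceAtTwo_of_facts_partnerSymbolMax
    (hES : eichlerShimura_depletedOptimalQuotient_periodLattice_of_dvd)
    (hF : WeierstrassCurve.isIsogenous_iff_frobeniusTrace_eq) (hMK : mazurKenku_exists_cyclic_isogeny)
    (hSD : heckeSelfDual_torsionBy_J0) (hBz : buzzard2000_multiplicityOne_gamma0)
    (hSe : serre1972_supersingular_decompositionSubgroup_image) (hD : Deligne1974_heckeT_eigenvalue_norm_le)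
    (hμg : ∀ (W : WeierstrassCurve ℚ) [W.IsElliptic] [W.IsGloballyMinimal], ¬ W.HasCM → W.analyticRank = 0 → Literature.NumberTheory.EllipticCurves.Rank1Residual.GoodSS W 2 → W.frobeniusTrace 2 = 0 → W.Δ < 0 → ∀ (M : ℕ) [NeZero M] (g : CuspForm (CongruenceSubgroup.Gamma0 M) 2) (ι : Literature.NumberTheory.EllipticCurves.ModularForms.coeffField g →+* PadicAlgCl 2) (Ω : ℂ), Odd M → Literature.NumberTheory.EllipticCurves.ModularForms.IsNewform0 g → Literature.NumberTheory.Automorphic.IsCMForm (Literature.NumberTheory.EllipticCurves.ModularForms.liftToGamma1 M 2 g) → Literature.NumberTheory.EllipticCurves.ModularForms.cuspCoeff g 2 = 0 → Literature.NumberTheory.EllipticCurves.IsPlusPeriod g Ω → (∀ ℓ : ℕ, ℓ.Prime → ¬ ℓ ∣ 2 * M * W.conductorNorm ℤ → ‖Literature.NumberTheory.EllipticCurves.embCoeff g ι ℓ - (W.frobeniusTrace ℓ : PadicAlgCl 2)‖ < 1) → ∀ [NeZero (W.conductorNorm ℤ)] (f : CuspForm (CongruenceSubgroup.Gamma0 (W.conductorNorm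 ℤ)) 2), Literature.NumberTheory.EllipticCurves.ModularForms.IsNewformOf W f → ∀ (S₀ : Finset (IsDedekindDomain.HeightOneSpectrum (NumberField.RingOfIntegers ℚ))), (∀ v ∈ S₀, ((2 : ℕ) : NumberField.RingOfIntegers ℚ) ∉ v.asIdeal) → (∀ v : IsDedekindDomain.HeightOneSpectrum (NumberField.RingOfIntegers ℚ), ¬ W.HasGoodReductionAt v → v ∈ S₀) → (∀ v : IsDedekindDomain.HeightOneSpectrum (NumberField.RingOfIntegers ℚ), Rat.HeightOneSpectrum.natGenerator v ∣ M → v ∈ S₀) → ∃ n₁ : ℕ, Even n₁ ∧ ∃ s : ZMod (2 ^ n₁), ∀ r : ℚ, ‖(∑ k ∈ Fintype.piFinset (fun _ : S₀ ↦ Finset.range 3), (∏ v : S₀, (1 - Polynomial.C (embCoeff g ι (Rat.HeightOneSpectrum.natGenerator (v : IsDedekindDomain.HeightOneSpectrum (NumberField.RingOfIntegers ℚ)))) * Polynomial.X + (if Rat.HeightOneSpectrum.natGenerator (v : IsDedekindDomain.HeightOneSpectrum (NumberField.RingOfIntegers ℚ)) ∣ M then 0 else Polynomial.C (Rat.HeightOneSpectrum.natGenerator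 (v : IsDedekindDomain.HeightOneSpectrum (NumberField.RingOfIntegers ℚ)) : PadicAlgCl 2)) * Polynomial.X ^ 2 : Polynomial (PadicAlgCl 2)).coeff (k v) * ((Rat.HeightOneSpectrum.natGenerator (v : IsDedekindDomain.HeightOneSpectrum (NumberField.RingOfIntegers ℚ)) : PadicAlgCl 2)⁻¹) ^ (k v)) * ι (plusSymbolK g Ω (r * ((∏ v : S₀, Rat.HeightOneSpectrum.natGenerator (v : IsDedekindDomain.HeightOneSpectrum (NumberField.RingOfIntegers ℚ)) ^ (k v) : ℕ) : ℚ))))‖ ≤ ‖(∑ k ∈ Fintype.piFinset (fun _ : S₀ ↦ Finset.range 3), (∏ v : S₀, (1 - Polynomial.C (embCoeff g ι (Rat.HeightOneSpectrum.natGenerator (v : IsDedekindDomain.HeightOneSpectrum (NumberField.RingOfIntegers ℚ)))) * Polynomial.X + (if Rat.HeightOneSpectrum.natGenerator (v : IsDedekindDomain.HeightOneSpectrum (NumberField.RingOfIntegers ℚ)) ∣ M then 0 else Polynomial.C (Rat.HeightOneSpectrum.natGenerator (v : IsDedekindDomain.HeightOneSpectrum (NumberField.RingOfIntegers ℚ))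 : PadicAlgCl 2)) * Polynomial.X ^ 2 : Polynomial (PadicAlgCl 2)).coeff (k v) * ((Rat.HeightOneSpectrum.natGenerator (v : IsDedekindDomain.HeightOneSpectrum (NumberField.RingOfIntegers ℚ)) : PadicAlgCl 2)⁻¹) ^ (k v)) * ι (plusSymbolK g Ω ((((((Literature.NumberTheory.EllipticCurves.cyclotomicGenerator 2 : ZMod (2 ^ (n₁ + 2))) ^ s.val).val : ℚ) / (2 : ℚ) ^ (n₁ + 2))) * ((∏ v : S₀, Rat.HeightOneSpectrum.natGenerator (v : IsDedekindDomain.HeightOneSpectrum (NumberField.RingOfIntegers ℚ)) ^ (k v) : ℕ) : ℚ))))‖) :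
    Summit.BirchSwinnertonDyer.BirchSwinnertonDyer.Theses.ResidualThetaTransportAtTwo.ThetaLayerLambdaCongruenceAtTwo := by
  intro W _ _ hcm hr hss ha hΔ M _ g ι Ω hodd hnew hcmg ha2 hΩ hcong _ f hf S₀ hS2 hSW hSM
  exact layerLambda_eventually_eq_of_facts_partnerSymbolMax_at hES hF hMK hSD hBz hSe hD hr hss ha hΔ g ι Ω hodd hnew ha2 hΩ
    hcong hf S₀ hS2 hSW hSM (hμg W hcm hr hss ha hΔ M g ι Ω hodd hnew hcmg ha2 hΩ hcong f hf S₀ hS2 hSW hSM)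

end Summit.BirchSwinnertonDyer.BirchSwinnertonDyer.Theorems.ThetaLayerLambdaCongruenceAtTwo

end
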